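import Mathlib
import Summits.Ventures.PercRepro.TriangleCapFourRowFourPieces
import Summits.Ventures.PercRepro.TriangleCapBroom

/-!
# PercRepro — THE ROW `a = 4` AT `r = 4`: a `K₄⁻`-free graph with `4 (k − 4) − 4` edges on `k ≥ 12` vertices is
`4`-bipartite or at least `4` below the closed form — hence THE SECOND-BEST VALUE OF THE CHERRY TABLE ON THE CELL
`(k, 4, 4)` IS `closed − 4`, the brooms (p3, gen 46; part 199r)

The first cell with `r ≥ 4` on a row `a ≥ 4` of §10bt(e)'s second-best table (parts 194–199 have every cell with
`r ≤ 3`): the bipartite second-best gap is `B1 = 2 (r − 2) = 4` (a broom or a `4`-cycle in the missing graph,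
`broom_or_c4_of_eq`), and every non-`4`-bipartite graph is at least `4` below (the one-triangle family `T` is
`2k − 14` below; the bound `4` is what the table needs). The induction on `k`: the cap is part 199p; every degree in
`[5, k − 5]` gives `k (k − 9)` by the convexity of the row `5`; a vertex `z` of degree `d ≤ 4` is deleted onto
`(k − 1, 4, d)` (part 199q): the diagonal, the cells `r' = 1, 2, 3` (parts 195–199d), and `r' = 4` — the induction
hypothesis for `k ≥ 13` and, AT THE CORNER `k = 12`, the diagonal `(11, 24)` of the row `a = 3` at third order
(part 199o: `K_{3,8}` makes `D` `4`-bipartite; `4`-bipartite `D − z` is the side lemma; the rest is `≤ 236` with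
`T ≤ 24`, `236 + 48 + 20 = 304 = m k − 32` exactly). `four_four_second_best (12 ≤ k)`: the second-best value of
`Σ_v d(v)²` over the non-extremal `K₄⁻`-free graphs on `Fin k` with `4 (k − 4) − 4` edges is EXACTLY
`m k − 4 (k − 5) − 4`, attained by `K_{4,k−4}` minus a broom (`broom_value`). Axioms: standard.
-/

namespace PercRepro

namespace TriangleCap

namespace C047

open Finset

universe u

variable {V : Type*} [Fintype V] [DecidableEq V]

/-- **THE ROW `a = 4` AT `r = 4`, EVERY VERTEX TYPE, BY INDUCTION ON `k`:** `K₄⁻`-free, `m + 4 = 4 (k − 4)`, `12 ≤ k`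
⇒ `4`-bipartite or `Σ_v d(v)² + 4 (k − 5) + 4 ≤ m k`. -/
theorem four_four_second_order_aux (n : ℕ) :
    ∀ (W : Type u) [Fintype W] [DecidableEq W] (D : SimpleGraph W) [DecidableRel D.Adj], Fintype.card W = n →
      K4mFree D → 12 ≤ Fintype.card W → D.edgeFinset.card + 4 = 4 * (Fintype.card W - 4) →
      (∃ A : Finset W, A.card = 4 ∧ BipSub D A) ∨
        ∑ v, deg D v * deg D v + 4 * (Fintype.card W - 5) + 4 ≤ D.edgeFinset.card * Fintype.card W := by
  refine Nat.strong_induction_on n ?_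
  intro n ih W _ _ D _ hn hK hk hm
  -- (A) a vertex at the cap `k − 4`
  by_cases hx : ∃ x, deg D x + 4 = Fintype.card W
  · obtain ⟨x, hx⟩ := hx
    exact four_four_cap D hK hk hm x hx
  push Not at hx
  have hcap : ∀ v, deg D v + 4 ≤ Fintype.card W := fun v =>
    deg_add_le_card_of_dense D hK 4 (by norm_num) (by omega)
      (cap_arith 4 (Fintype.card W) D.edgeFinset.card 4 (by norm_num) (by omega) (by omega)) v
  have hcap' : ∀ v, deg D v + 5 ≤ Fintype.card W := fun v => by
    have h1 := hcap v
    have h2 := hx v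
    omega
  have hcap6 : ∀ v, deg D v ≤ (Fintype.card W - 6) + 1 := fun v => by have := hcap' v; omega
  -- (B) every degree `≥ 5`: the convexity of the row `5`
  by_cases hdeg : ∀ v, 5 ≤ deg D v
  · right
    have h := below_convex_gen D 4 4 (by norm_num) (by omega) hm hcap' hdeg
    have h2 : 2 * (Fintype.card W - 2 * 4 - 1) ≤ Fintype.card W * (Fintype.card W - 2 * 4 - 1) :=
      Nat.mul_le_mul_right _ (by omega)
    omega
  push Not at hdeg
  obtain ⟨z, hz⟩ := hdeg
  -- the deletion bookkeeping
  have hK' := k4mFree_del D hK z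
  have hcard' := card_del z
  have hedges' := card_edges_del D z
  have hsq := sum_deg_sq_del D z
  have hT := sum_del_nbhd_le D z (Fintype.card W - 6) hcap6
  have hNz := card_nbhd_del D z
  obtain ⟨T, hTdef⟩ : ∃ T, ∑ a : {v : W // v ≠ z}, (if D.Adj a.1 z then deg (del D z) a else 0) = T := ⟨_, rfl⟩
  obtain ⟨S', hS'def⟩ : ∃ S', ∑ a : {v : W // v ≠ z}, deg (del D z) a * deg (del D z) a = S' := ⟨_, rfl⟩
  obtain ⟨m', hm'def⟩ : ∃ m', (del D z).edgeFinset.card = m' := ⟨_, rfl⟩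
  obtain ⟨Nz, hNzdef⟩ : ∃ Nz : Finset {v : W // v ≠ z},
      Nz = univ.filter (fun a : {v : W // v ≠ z} => D.Adj a.1 z) := ⟨_, rfl⟩
  have hmemNz : ∀ a : {v : W // v ≠ z}, a ∈ Nz ↔ D.Adj a.1 z := fun a => by
    rw [hNzdef, mem_filter]
    simp only [mem_univ, true_and]
  rw [← hNzdef] at hNz
  rw [hTdef, hS'def] at hsq
  rw [hTdef] at hT
  rw [hm'def] at hedges'
  obtain ⟨s, hs⟩ : ∃ s, Fintype.card W = s + 12 := ⟨Fintype.card W - 12, by omega⟩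
  have hcardW' : Fintype.card {v : W // v ≠ z} = s + 11 := by omega
  -- the side lemma for a `4`-bipartite `D − z` (`d ≥ 1`)
  have hside : 1 ≤ deg D z → ∀ A' : Finset {v : W // v ≠ z}, A'.card = 4 → BipSub (del D z) A' →
      (∃ A : Finset W, A.card = 4 ∧ BipSub D A) ∨
        (∑ v, deg D v * deg D v + 4 * (Fintype.card W - 5) + 4 ≤ D.edgeFinset.card * Fintype.card W) ∨
        (T + (Fintype.card W - 6) ≤ deg D z * (Fintype.card W - 6) + 4) := by
    intro hd1 A' hA'card hB
    have := four_four_sides D hk hm z hd1 (by omega) A' hA'card hB (by rw [hm'def]; omega) hcap6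
    rw [hTdef] at this
    exact this
  have hd : deg D z = 0 ∨ deg D z = 1 ∨ deg D z = 2 ∨ deg D z = 3 ∨ deg D z = 4 := by omega
  rcases hd with hd0 | hd1 | hd2 | hd3 | hd4
  · -- `d = 0`: the diagonal `(k − 1, 4, 0)`
    have hm'0 : m' = 4 * s + 28 := by omega
    rcases diag_second_order_gen (del D z) hK' 4 (le_refl 4) (by omega) (by rw [hm'def, hcardW', hm'0]; omega)
      with ⟨A', hA'card, hB⟩ | hgap
    · obtain ⟨B, hBcard, hBsub⟩ := bipSub_lift D z A' hB (fun a ha => by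
        have : a ∈ Nz := (hmemNz a).mpr ha
        rw [hd0, card_eq_zero] at hNz
        rw [hNz] at this
        exact absurd this (notMem_empty a))
      exact Or.inl ⟨B, by rw [hBcard, hA'card], hBsub⟩
    · right
      rw [hS'def, hm'def, hcardW'] at hgap
      rw [hd0, hs] at hT
      rw [hsq, ← hedges', hs, hd0]
      exact four_four_del_zero_arith s m' S' T hm'0 hgap hT
  · -- `d = 1`: the cell `(k − 1, 4, 1)`
    have hm'1 : m' = 4 * s + 27 := by omega
    rcases one_below_second_order_gen (del D z) hK' 4 (le_refl 4) (by omega)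
      (by rw [hm'def, hcardW', hm'1]; omega) with ⟨A', hA'card, hB⟩ | hgap
    · rcases hside (by omega) A' hA'card hB with h | h | hT'
      · exact Or.inl h
      · exact Or.inr h
      · -- a single neighbour cannot be mixed; the bound still closes
        right
        have hS := sum_deg_sq_le_of_bipSub (del D z) A' hB 4 1 hA'card (by rw [hm'def, hcardW', hm'1]; omega)
          (by omega)
        rw [hS'def, hm'def, hcardW'] at hS
        rw [hs, hd1] at hT'
        rw [hsq, ← hedges', hs, hd1]
        have e1 : s + 11 - 1 - 1 = s + 9 := by omega
        have e2 : s + 12 - 5 = s + 7 := by omega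
        have e4 : s + 12 - 6 = s + 6 := by omega
        rw [e1] at hS
        rw [e4] at hT'
        rw [e2]
        subst hm'1
        nlinarith [hS, hT']
    · right
      rw [hS'def, hm'def, hcardW'] at hgap
      rw [hd1, hs] at hT
      rw [hsq, ← hedges', hs, hd1]
      exact four_four_del_one_gap_arith s m' S' T hm'1 hgap hT
  · -- `d = 2`: the cell `(k − 1, 4, 2)`
    have hm'2 : m' = 4 * s + 26 := by omega
    rcases four_two_second_order (del D z) hK' (by omega) (by rw [hm'def, hcardW', hm'2]; omega)
      with ⟨A', hA'card, hB⟩ | hgap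
    · rcases hside (by omega) A' hA'card hB with h | h | hT'
      · exact Or.inl h
      · exact Or.inr h
      · right
        have hS := sum_deg_sq_le_of_bipSub (del D z) A' hB 4 2 hA'card (by rw [hm'def, hcardW', hm'2]; omega)
          (by omega)
        rw [hS'def, hm'def, hcardW'] at hS
        rw [hs, hd2] at hT'
        rw [hsq, ← hedges', hs, hd2]
        exact four_four_del_two_mixed_arith s m' S' T hm'2 hS hT'
    · right
      rw [hS'def, hm'def, hcardW'] at hgap
      rw [hd2, hs] at hT
      rw [hsq, ← hedges', hs, hd2]
      exact four_four_del_two_gap_arith s m' S' T hm'2 hgap hT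
  · -- `d = 3`: the cell `(k − 1, 4, 3)`
    have hm'3 : m' = 4 * s + 25 := by omega
    rcases four_three_second_order (del D z) hK' (by omega) (by rw [hm'def, hcardW', hm'3]; omega)
      with ⟨A', hA'card, hB⟩ | hgap
    · rcases hside (by omega) A' hA'card hB with h | h | hT'
      · exact Or.inl h
      · exact Or.inr h
      · right
        have hS := sum_deg_sq_le_of_bipSub (del D z) A' hB 4 3 hA'card (by rw [hm'def, hcardW', hm'3]; omega)
          (by omega)
        rw [hS'def, hm'def, hcardW'] at hS
        rw [hs, hd3] at hT'
        rw [hsq, ← hedges', hs, hd3]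
        exact four_four_del_three_mixed_arith s m' S' T hm'3 hS hT'
    · right
      rw [hS'def, hm'def, hcardW'] at hgap
      rw [hd3, hs] at hT
      rw [hsq, ← hedges', hs, hd3]
      exact four_four_del_three_gap_arith s m' S' T hm'3 hgap hT
  · -- `d = 4`: the cell `(k − 1, 4, 4)`
    have hm'4 : m' = 4 * s + 24 := by omega
    rcases Nat.eq_zero_or_pos s with hs0 | hspos
    · -- the corner `k = 12`: `D − z` on the diagonal `(11, 24)` at third order
      subst hs0
      have hk12 : Fintype.card W = 12 := by omega
      have hcard11 : Fintype.card {v : W // v ≠ z} = 11 := by omega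
      have hm'24 : m' = 24 := by omega
      rcases three_diag_third_order_eleven (del D z) hK' hcard11 (by rw [hm'def, hm'24])
        with ⟨A', hA'card, hA'⟩ | ⟨A', hA'card, hB⟩ | hthird
      · -- `D − z = K_{3,8}`: the four neighbours of `z` lie off the `3`-side
        have hfull : ∀ {x y : {v : W // v ≠ z}}, x ∈ A' → y ∉ A' → (del D z).Adj x y := fun hx hy =>
          adj_of_bipSub_full (del D z) A' hA' 3 hA'card (by rw [hm'def, hcard11, hm'24]) hx hy
        have hall : ¬ ∀ a : {v : W // v ≠ z}, D.Adj a.1 z → a ∈ A' := by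
          intro hall
          have hsub : Nz ⊆ A' := fun a ha => hall a ((hmemNz a).mp ha)
          have := card_le_card hsub
          omega
        push Not at hall
        obtain ⟨a₀, ha₀z, ha₀A⟩ := hall
        have hoff : ∀ a : {v : W // v ≠ z}, D.Adj a.1 z → a ∉ A' := by
          intro a₁ ha₁z ha₁A
          have hne01 : a₀ ≠ a₁ := fun h => ha₀A (h ▸ ha₁A)
          obtain ⟨a₂, ha₂z, ha₂0, ha₂1⟩ : ∃ a₂ : {v : W // v ≠ z}, D.Adj a₂.1 z ∧ a₂ ≠ a₀ ∧ a₂ ≠ a₁ := by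
            have h2 : 2 < Nz.card := by omega
            obtain ⟨b₁, hb₁, b₂, hb₂, b₃, hb₃, h12, h13, h23⟩ := two_lt_card.mp h2
            rw [hmemNz] at hb₁ hb₂ hb₃
            by_cases e1 : b₁ = a₀ ∨ b₁ = a₁
            · by_cases e2 : b₂ = a₀ ∨ b₂ = a₁
              · refine ⟨b₃, hb₃, ?_, ?_⟩
                · intro h; rcases e1 with rfl | rfl <;> rcases e2 with rfl | rfl <;>
                    first | exact h12 rfl | exact h13 h | exact h13 h.symm | exact h23 h | exact h23 h.symm
                · intro h; rcases e1 with rfl | rfl <;> rcases e2 with rfl | rfl <;>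
                    first | exact h12 rfl | exact h13 h | exact h13 h.symm | exact h23 h | exact h23 h.symm
              · push Not at e2
                exact ⟨b₂, hb₂, e2.1, e2.2⟩
            · push Not at e1
              exact ⟨b₁, hb₁, e1.1, e1.2⟩
          have h10 : D.Adj a₁.1 a₀.1 := (del_adj D z a₁ a₀).mp (hfull ha₁A ha₀A)
          by_cases ha₂A : a₂ ∈ A'
          · have h20 : D.Adj a₂.1 a₀.1 := (del_adj D z a₂ a₀).mp (hfull ha₂A ha₀A)
            exact not_adj_both D hK (D.adj_symm ha₀z) (D.adj_symm ha₁z) (D.adj_symm h10)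
              (fun h => ha₂1 (Subtype.ext h).symm) (D.adj_symm ha₂z) (D.adj_symm h20)
          · have h12' : D.Adj a₁.1 a₂.1 := (del_adj D z a₁ a₂).mp (hfull ha₁A ha₂A)
            exact not_adj_both D hK (D.adj_symm ha₁z) (D.adj_symm ha₀z) h10
              (fun h => ha₂0 (Subtype.ext h).symm) (D.adj_symm ha₂z) h12'
        obtain ⟨B, hBcard, hB⟩ := bipSub_insert_of_nbhd_off D z A' hA' hoff
        exact Or.inl ⟨B, by rw [hBcard, hA'card], hB⟩
      · -- `D − z` is `4`-bipartite on `(11, 4, 4)`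
        rcases hside (by omega) A' hA'card hB with h | h | hT'
        · exact Or.inl h
        · exact Or.inr h
        · right
          have hS := sum_deg_sq_le_of_bipSub (del D z) A' hB 4 4 hA'card (by rw [hm'def, hcard11, hm'24])
            (by omega)
          rw [hS'def, hm'def, hcard11, hm'24] at hS
          rw [hk12, hd4] at hT'
          rw [hsq, ← hedges', hk12, hd4, hm'24]
          omega
      · -- neither: at most `236`, `T ≤ 24`
        right
        rw [hS'def, hm'def, hcard11, hm'24] at hthird
        rw [hd4, hk12] at hT
        rw [hsq, ← hedges', hk12, hd4, hm'24]
        omega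
    · -- `k ≥ 13`: the induction hypothesis on `(k − 1, 4, 4)`
      rcases ih (Fintype.card {v : W // v ≠ z}) (by omega) {v : W // v ≠ z} (del D z) rfl hK' (by omega)
        (by rw [hm'def, hcardW', hm'4]; omega) with ⟨A', hA'card, hB⟩ | hgap
      · rcases hside (by omega) A' hA'card hB with h | h | hT'
        · exact Or.inl h
        · exact Or.inr h
        · right
          have hS := sum_deg_sq_le_of_bipSub (del D z) A' hB 4 4 hA'card (by rw [hm'def, hcardW', hm'4]; omega)
            (by omega)
          rw [hS'def, hm'def, hcardW'] at hS
          rw [hs, hd4] at hT'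
          rw [hsq, ← hedges', hs, hd4]
          exact four_four_del_four_mixed_arith s m' S' T hm'4 hS hT'
      · right
        rw [hS'def, hm'def, hcardW'] at hgap
        rw [hd4, hs] at hT
        rw [hsq, ← hedges', hs, hd4]
        exact four_four_del_four_gap_arith s m' S' T hm'4 hgap hT

/-- **THE ROW `a = 4` AT `r = 4`:** `K₄⁻`-free, `m + 4 = 4 (k − 4)`, `12 ≤ k` ⇒ `D` is a spanning subgraph of some
`K(A, Aᶜ)` with `|A| = 4`, or `Σ_v d(v)² + 4 (k − 5) + 4 ≤ m k`. -/
theorem four_four_second_order (D : SimpleGraph V) [DecidableRel D.Adj] (hK : K4mFree D)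
    (hk : 12 ≤ Fintype.card V) (hm : D.edgeFinset.card + 4 = 4 * (Fintype.card V - 4)) :
    (∃ A : Finset V, A.card = 4 ∧ BipSub D A) ∨
      ∑ v, deg D v * deg D v + 4 * (Fintype.card V - 5) + 4 ≤ D.edgeFinset.card * Fintype.card V :=
  four_four_second_order_aux (Fintype.card V) V D rfl hK hk hm

/-- **THE SECOND-BEST VALUE ON `(k, 4, 4)`, `k ≥ 12`:** every non-extremal `K₄⁻`-free graph on `Fin k` with
`4 (k − 4) − 4` edges has `Σ_v d(v)² + 4 (k − 5) + 4 ≤ m k`, and the value is attained (`K_{4,k−4}` minus a broom). -/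
theorem four_four_second_best (k : ℕ) (hk : 12 ≤ k) :
    (∀ (D : SimpleGraph (Fin k)) [DecidableRel D.Adj], K4mFree D → D.edgeFinset.card + 4 = 4 * (k - 4) →
        ∑ v, deg D v * deg D v + 4 * (k - 5) ≠ D.edgeFinset.card * k →
        ∑ v, deg D v * deg D v + 4 * (k - 5) + 4 ≤ D.edgeFinset.card * k) ∧
      ∃ (D : SimpleGraph (Fin k)) (_ : DecidableRel D.Adj), K4mFree D ∧ D.edgeFinset.card + 4 = 4 * (k - 4) ∧
        ∑ v, deg D v * deg D v + 4 * (k - 5) + 4 = D.edgeFinset.card * k := by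
  have hcard : Fintype.card (Fin k) = k := Fintype.card_fin k
  refine ⟨?_, ?_⟩
  · intro D _ hK hm hne
    rcases four_four_second_order D hK (by omega) (by rw [hcard]; exact hm) with ⟨A, hAcard, hB⟩ | h
    · -- `4`-bipartite: the missing graph is not a star (else extremal), so `closed − 4` by the broom bound
      by_cases hstar : ∃ v, MissingStar D A v
      · obtain ⟨v, hv⟩ := hstar
        have h := closed_form_eq_of_missingStar D A hB hv 4 4 hAcard (by rw [hcard]; omega) (by omega)
        rw [hcard] at h
        have e : k - 1 - 4 = k - 5 := by omega
        rw [e] at h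
        exact absurd h hne
      · have h := closed_form_stability_bipSub D A hB 4 4 hAcard (by rw [hcard]; omega) (by omega) (by norm_num)
          hstar
        rw [hcard] at h
        have e : k - 1 - 4 = k - 5 := by omega
        rw [e] at h
        omega
    · rw [hcard] at h
      exact h
  · obtain ⟨D, inst, A, hK, hAcard, hB, hns, hE, hS⟩ := broom_value k 4 4 (by norm_num) (by norm_num) (by omega)
    have hE' : D.edgeFinset.card + 4 = 4 * (k - 4) := by
      rw [hE]
      have : 4 ≤ 4 * (k - 4) := by omega
      omega
    refine ⟨D, inst, hK, hE', ?_⟩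
    have e : k - 1 - 4 = k - 5 := by omega
    rw [e] at hS
    rw [hE]
    have e2 : 2 * (4 - 2) = 4 := by norm_num
    rw [e2] at hS
    exact hS

end C047

end TriangleCap

end PercRepro
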